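/-
Copyright (c) 2026 the pub-hodgecm-mathlib formalisation cell (harness21).  Prover seat hodgecm-mathlib-K2E4-p07 (g2),
Track B «K2-LIT» ∕ h413, unit «FinGermConstants» of the line `K2_E4_SingularTransferKappaSign`, socket #7R
`K2E4SingularTransferKappaSign.FinGermConstants.sig_K2E3GermConstantRegularHR` (ED. 4), STEP (iv-a) of its non-split residue: the ENTRY-BOX CRITERION for neighbourhoods of the scalar `a·1₂` in `U(Φ₂)_v` at a non-split place.  2026-09-03.
-/
import Literature.NumberTheory.Rogawski1990.LocalNormFibreBoundedReps                        -- ★ `LocalUnitaryRankTwoHilbertSection` kit (`norm_conjLocal_apply`, …) and the local carriers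
import Literature.NumberTheory.Rogawski1990.LocalStableClassesNonsplitScalarFrameKappa       -- ★ `conjLocal_mul_self_of_fst_eq_smul_one`
import HarnessLib

/-!
# K2_E4 road (h413 = stmt-HodgeConjecture-24833), socket #7R `sig_K2E3GermConstantRegularHR`, non-split residue STEP (iv-a):
# neighbourhoods of `a·1₂` in `U(Φ₂)_v ≤ GL₂(L_w)` contain an ENTRY-BOX

Cell `pub/hodgecm-mathlib` (D-0151), Track B; socket **`sig_K2E3GermConstantRegularHR`** (FinGermConstants ED. 3∕4 :309, R-twin of #7; OWNER K2E3, base K2E4-p07).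
Topological plumbing for the near-central representatives of STEP (iv) (★ `K2E3GermConstantRegularHRNearCentral`): at a non-split `v` (one place `w ∣ v`, `R = L_w`) the
topology of `U(Φ₂)_v ≤ GL₂(R)` is induced by `g ↦ (g, g⁻¹) ∈ M₂(R) × M₂(R)ᵐᵒᵖ` (Mathlib `Units.isInducing_embedProduct`), and a neighbourhood of `x ∈ R = ∏_{w ∣ v} L_w`
contains a `w`-ball (`R ≃ₜ L_w`, Mathlib `Homeomorph.piUnique`).  Hence a neighbourhood `V₁ ∋ a·1₂` (`σ(a)a = 1`) contains every `g = [[x, y], [z, x]] ∈ U(Φ₂)_v` with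
`g⁻¹ = [[σx, σy], [σz, σx]]` and `‖x_w − a_w‖, ‖y_w‖, ‖z_w‖ < ρ` for some `ρ > 0` (the pair `(g, g⁻¹)` is a continuous function of `(x, y, z)` taking the value
`(a·1₂, σ(a)·1₂) = (ε_H.1, ε_H.1⁻¹)` at `(a, 0, 0)`).  [PlatonovRapinchuk1994 §3.3 (topology of `p`-adic groups), §5.1 (the one-place model).]

* **`exists_norm_lt_imp_mem_of_mem_nhds`** — the entry-box criterion.

HONEST LABEL: HC_CM is proved only modulo the 7 printed citations (2 remaining named inputs: hLiu418 = stmt-HodgeConjecture-24832, h413 =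
stmt-HodgeConjecture-24833) until rung 0 closes; this file is a `--supports stmt-HodgeConjecture-24833` helper (topology only) and retires nothing by itself.
-/

set_option autoImplicit false
set_option linter.dupNamespace false

noncomputable section

open Set Filter Topology Matrix NumberField IsDedekindDomain
open scoped MatrixGroups Pointwise

namespace Summit.HodgeConjecture.HodgeConjecture.Cruxes.H413.K2E3GermConstantRegularHRNearCentralBox

open Literature.NumberTheory.Rogawski1990
open Literature.NumberTheory.Automorphic Literature.NumberTheory.Automorphic.UnitaryGroup

section Box

variable (L : Type) [Field L] [NumberField L] [IsCMField L] (v : HeightOneSpectrum (𝓞 ↥(maximalRealSubfield L)))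
  (w : PlacesOver L v) (hw : IsCMField.complexConj L • w.1 = w.1)

omit [IsCMField L] in
/-- At a place with ONE prime above it, a neighbourhood of `x ∈ R = ∏_{w ∣ v} L_w` contains a `w`-ball: `‖y_w − x_w‖ < ρ ⇒ y ∈ P`.
[cite: PlatonovRapinchuk1994, §5.1] -/
private theorem exists_ball_imp_mem_of_mem_nhds (hv : Subsingleton (PlacesOver L v)) {x : LocalRing L v} {P : Set (LocalRing L v)} (hP : P ∈ 𝓝 x) :
    ∃ ρ : ℝ, 0 < ρ ∧ ∀ y : LocalRing L v, ‖y w - x w‖ < ρ → y ∈ P := by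
  letI : Unique (PlacesOver L v) := @uniqueOfSubsingleton _ hv w
  let φ : LocalRing L v ≃ₜ w.1.adicCompletion L := Homeomorph.piUnique fun w' : PlacesOver L v => w'.1.adicCompletion L
  have hφ : ∀ y : LocalRing L v, φ y = y w := fun _ => rfl
  have hP' : φ '' P ∈ 𝓝 (φ x) := φ.isOpenMap.image_mem_nhds hP
  obtain ⟨ρ, hρ, hball⟩ := Metric.mem_nhds_iff.1 hP'
  refine ⟨ρ, hρ, fun y hy => ?_⟩
  have hyb : φ y ∈ Metric.ball (φ x) ρ := by rw [Metric.mem_ball, dist_eq_norm, hφ, hφ]; exact hy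
  obtain ⟨z, hzP, hz⟩ := hball hyb
  rwa [← φ.injective hz]

/-! ## §1  Neighbourhoods of `ε_H.1 = a·1₂` in `U(Φ₂)_v` read on entries -/

include hw in
/-- **Entry-box criterion for neighbourhoods in `U(Φ₂)_v`.**  For `V₁ ∈ 𝓝 (a·1₂)` in `U(Φ₂)_v` (`σ(a)a = 1`) there is `ρ > 0` such that every `g ∈ U(Φ₂)_v` with
`g = [[x, y], [z, x]]`, `g⁻¹ = [[σx, σy], [σz, σx]]` and `‖x_w − a_w‖, ‖y_w‖, ‖z_w‖ < ρ` lies in `V₁` (the topology of `U(Φ₂)_v ≤ GL₂(R)` is induced by `g ↦ (g, g⁻¹) ∈ M₂(R) × M₂(R)ᵐᵒᵖ`,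
and `R = L_w` at a non-split place). [cite: PlatonovRapinchuk1994, §3.3; §5.1] -/
theorem exists_norm_lt_imp_mem_of_mem_nhds
    (e₁ : (cmDatum L 2 (Matrix.of fun i j : Fin 2 => if i.val + j.val + 1 = 2 then (1 : L) else 0)).Local v) (a : LocalRing L v)
    (ha : (e₁.val.val : Matrix (Fin 2) (Fin 2) (LocalRing L v)) = a • (1 : Matrix (Fin 2) (Fin 2) (LocalRing L v)))
    {V₁ : Set ((cmDatum L 2 (Matrix.of fun i j : Fin 2 => if i.val + j.val + 1 = 2 then (1 : L) else 0)).Local v)} (hV₁ : V₁ ∈ 𝓝 e₁) :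
    ∃ ρ : ℝ, 0 < ρ ∧ ∀ (g : (cmDatum L 2 (Matrix.of fun i j : Fin 2 => if i.val + j.val + 1 = 2 then (1 : L) else 0)).Local v) (x y z : LocalRing L v),
      (g.val.val : Matrix (Fin 2) (Fin 2) (LocalRing L v)) = !![x, y; z, x] →
      ((g.val⁻¹ : GL (Fin 2) (LocalRing L v)).val : Matrix (Fin 2) (Fin 2) (LocalRing L v)) =
        !![conjLocal L (IsCMField.complexConj L) v x, conjLocal L (IsCMField.complexConj L) v y; conjLocal L (IsCMField.complexConj L) v z, conjLocal L (IsCMField.complexConj L) v x] →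
      ‖x w - a w‖ < ρ → ‖y w‖ < ρ → ‖z w‖ < ρ → g ∈ V₁ := by
  have hv : Subsingleton (PlacesOver L v) := PlacesOver.subsingleton_of_smul_eq (IsCMField.complexConj L) (IsCMField.complexConj_ne_one L) w hw
  set σ := conjLocal L (IsCMField.complexConj L) v with hσdef
  have hσa : σ a * a = 1 := conjLocal_mul_self_of_fst_eq_smul_one L v ((e₁, 1) : (cmDatum L 2 (Matrix.of fun i j : Fin 2 => if i.val + j.val + 1 = 2 then (1 : L) else 0)).Local v ×
      (cmDatum L 1 (Matrix.of fun i j : Fin 1 => if i.val + j.val + 1 = 1 then (1 : L) else 0)).Local v) ha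
  -- the inducing map `g ↦ (g, op g⁻¹)`
  let F : (cmDatum L 2 (Matrix.of fun i j : Fin 2 => if i.val + j.val + 1 = 2 then (1 : L) else 0)).Local v →
      Matrix (Fin 2) (Fin 2) (LocalRing L v) × (Matrix (Fin 2) (Fin 2) (LocalRing L v))ᵐᵒᵖ := fun g => Units.embedProduct _ g.val
  have hF : IsInducing F := Units.isInducing_embedProduct.comp IsInducing.subtypeVal
  rw [hF.nhds_eq_comap, mem_comap] at hV₁
  obtain ⟨T, hT, hTV⟩ := hV₁
  -- the continuous family `(x, y, z) ↦ ([[x,y],[z,x]], op [[σx,σy],[σz,σx]])`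
  let Ψ : LocalRing L v × (LocalRing L v × LocalRing L v) → Matrix (Fin 2) (Fin 2) (LocalRing L v) × (Matrix (Fin 2) (Fin 2) (LocalRing L v))ᵐᵒᵖ :=
    fun q => (!![q.1, q.2.1; q.2.2, q.1], MulOpposite.op !![σ q.1, σ q.2.1; σ q.2.2, σ q.1])
  have hσc : Continuous σ := continuous_conjLocal L (IsCMField.complexConj L) v
  have hΨc : Continuous Ψ := by
    refine Continuous.prodMk ?_ (MulOpposite.continuous_op.comp ?_)
    · refine continuous_matrix fun i j => ?_
      fin_cases i <;> fin_cases j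
      · simpa using continuous_fst
      · simpa using continuous_snd.fst
      · simpa using continuous_snd.snd
      · simpa using continuous_fst
    · refine continuous_matrix fun i j => ?_
      fin_cases i <;> fin_cases j
      · simpa using hσc.comp' continuous_fst
      · simpa using hσc.comp' continuous_snd.fst
      · simpa using hσc.comp' continuous_snd.snd
      · simpa using hσc.comp' continuous_fst
  -- its value at `(a, 0, 0)` is `F e₁`
  have hinv : ((e₁.val⁻¹ : GL (Fin 2) (LocalRing L v)).val : Matrix (Fin 2) (Fin 2) (LocalRing L v)) = σ a • (1 : Matrix (Fin 2) (Fin 2) (LocalRing L v)) := by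
    rw [Matrix.coe_units_inv, ha]
    refine Matrix.inv_eq_left_inv ?_
    rw [smul_mul_smul_comm, Matrix.one_mul, hσa, one_smul]
  have hΨ0 : Ψ (a, 0, 0) = F e₁ := by
    refine Prod.ext ?_ ?_
    · change !![a, 0; 0, a] = (e₁.val.val : Matrix (Fin 2) (Fin 2) (LocalRing L v))
      rw [ha]
      ext i j; fin_cases i <;> fin_cases j <;> simp
    · change MulOpposite.op !![σ a, σ 0; σ 0, σ a] = MulOpposite.op ((e₁.val⁻¹ : GL (Fin 2) (LocalRing L v)).val : Matrix (Fin 2) (Fin 2) (LocalRing L v))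
      rw [hinv, map_zero]
      congr 1
      ext i j; fin_cases i <;> fin_cases j <;> simp
  have hpre : Ψ ⁻¹' T ∈ 𝓝 ((a, 0, 0) : LocalRing L v × (LocalRing L v × LocalRing L v)) :=
    hΨc.continuousAt.preimage_mem_nhds (by rw [hΨ0]; exact hT)
  obtain ⟨P₁, hP₁, P₂₃, hP₂₃, hP⟩ := mem_nhds_prod_iff.1 hpre
  obtain ⟨P₂, hP₂, P₃, hP₃, hP'⟩ := mem_nhds_prod_iff.1 hP₂₃
  obtain ⟨ρ₁, hρ₁, h₁⟩ := exists_ball_imp_mem_of_mem_nhds L v w hv hP₁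
  obtain ⟨ρ₂, hρ₂, h₂⟩ := exists_ball_imp_mem_of_mem_nhds L v w hv hP₂
  obtain ⟨ρ₃, hρ₃, h₃⟩ := exists_ball_imp_mem_of_mem_nhds L v w hv hP₃
  refine ⟨min ρ₁ (min ρ₂ ρ₃), lt_min hρ₁ (lt_min hρ₂ hρ₃), fun g x y z hg hgi hx hy hz => ?_⟩
  apply hTV
  rw [mem_preimage]
  have hxyz : (x, y, z) ∈ Ψ ⁻¹' T := by
    refine hP (Set.mk_mem_prod (h₁ x (hx.trans_le (min_le_left _ _))) (hP' (Set.mk_mem_prod ?_ ?_)))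
    · exact h₂ y (by rw [Pi.zero_apply, sub_zero]; exact hy.trans_le ((min_le_right _ _).trans (min_le_left _ _)))
    · exact h₃ z (by rw [Pi.zero_apply, sub_zero]; exact hz.trans_le ((min_le_right _ _).trans (min_le_right _ _)))
  have hFg : F g = Ψ (x, y, z) := Prod.ext hg (congrArg MulOpposite.op hgi)
  rw [hFg]
  exact hxyz

end Box

end Summit.HodgeConjecture.HodgeConjecture.Cruxes.H413.K2E3GermConstantRegularHRNearCentralBox

end
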